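import Summits.CriticalPhenomena.PercolationContinuityZ3.Theorems.PercNearOneGluingNoHeavyPcintBFibExplore
import Summits.CriticalPhenomena.PercolationContinuityZ3.Theorems.PercNearOneGluingNoHeavyPcintUFibProcess
import HarnessLib

/-!
# PCINT lane, T-fibre route PHASE 3 (bond), step (2): the usable-set fibre process for BOND percolation on `𝕋 × F`

Cell `prim-pcint`, seat `prim-pcint-1` (gen 13); memo `run/shared/lean/prim/pcint/T-FIBRE-ROUTE.md` (PHASE 3).

The bond version of `…PcintUFibProcess.lean`.  The exploration examines the EDGES of the triangular lattice `𝕋` inside a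
finite `Λ` (`EdgeExpl.rule`); the second process lives on `𝕋 × F` for a finite fibre graph `F` on `Φ` and carries one
BLOCK of bits per site `v ∈ Λ` (the internal edges of the fibre of `v`, read through an edge key `ek : Φ → Φ → Φ × Φ`) and one
block per `𝕋`-edge `e = {c, a}` (the `#Φ` layer edges `((c,i),(a,i))`); both kinds of block are valued in the common type
`BFib.Blk Φ = ((Φ × Φ) ⊕ Φ → Bool)` (the unused half of each block is never read).

* A reached site `v` carries a USABLE SET `U_v ⊆ Φ` of cells joined to the root cell `(o, i₀)`: the root has `U_o = Φ`
  when all bits of its block are set (`rootU`; the weight of the route conditions on this), and a site `v` ENTERED from the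
  selected site `c` through the edge `{c, v}` receives `υ grow h U_c y` = the set `grow y i` grown inside the fibre of `v`
  from ONE entry cell `i ∈ U_c` whose layer edge is open (`h i = true`), for a growth rule `grow` (sound when every grown cell
  is joined to the entry cell by open internal edges, hypothesis `hgrow` below).
* The oracle `outB` reports, for an examined edge `e = {c, a}` (`c` selected), whether some layer edge of `e` at a usable cell
  of `c` is open (`UFib.meetsU (hOf w e) U_c`); `U_c` is computed by replaying the state (`usableX`, `usableAt`, as in PHASE 2).
* Calculus (`usableX_root/_stable/_congr`, `usableAt_run`); soundness `joined_of_mem_usableX`, `exists_joined_of_reach`.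
-/

noncomputable section

namespace Summit.CriticalPhenomena.PercolationContinuityZ3.Theorems.Pcint

namespace BFib

open Finset AdaptDom EdgeExpl UFib Literature.Probability.Percolation Literature.Probability.LatticeModels

variable {Φ : Type*} [Fintype Φ]

/-- The common value type of the blocks: bits indexed by `Φ × Φ` (internal edge keys) and by `Φ` (layers). -/
abbrev Blk (Φ : Type*) := ((Φ × Φ) ⊕ Φ) → Bool

variable {Λ : Finset (Site 2)}

/-- The internal bits of the block of the site `v`. -/
def yOf (w : (↥Λ ⊕ ↥(EΛ triGraph Λ)) → Blk Φ) (v : ↥Λ) : Φ × Φ → Bool := fun k => w (Sum.inl v) (Sum.inl k)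

/-- The layer bits of the block of the edge `e`. -/
def hOf (w : (↥Λ ⊕ ↥(EΛ triGraph Λ)) → Blk Φ) (e : ↥(EΛ triGraph Λ)) : Φ → Bool := fun i => w (Sum.inr e) (Sum.inr i)

/-- The layer bits of the edge `{c, v}` (all `false` if `{c, v}` is not an item). -/
def hE (w : (↥Λ ⊕ ↥(EΛ triGraph Λ)) → Blk Φ) (c v : ↥Λ) : Φ → Bool := fun i =>
  if h : s(c.1, v.1) ∈ EΛ triGraph Λ then w (Sum.inr ⟨s(c.1, v.1), h⟩) (Sum.inr i) else false

omit [Fintype Φ] in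
/-- `hE` at an item is `hOf`. -/
theorem hE_eq_hOf (w : (↥Λ ⊕ ↥(EΛ triGraph Λ)) → Blk Φ) {c v : ↥Λ} {e : ↥(EΛ triGraph Λ)}
    (he : (e : Sym2 (Site 2)) = s(c.1, v.1)) : hE w c v = hOf w e := by
  funext i
  have hmem : s(c.1, v.1) ∈ EΛ triGraph Λ := he ▸ e.2
  have : (⟨s(c.1, v.1), hmem⟩ : ↥(EΛ triGraph Λ)) = e := Subtype.ext he.symm
  simp only [hE, hOf, dif_pos hmem, this]

variable (o : ↥Λ) (enc : ↥Λ → ℕ)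

/-- **The root usable set**: `Φ` if every bit of the block of `o` is set, `∅` otherwise. -/
def rootU (w : (↥Λ ⊕ ↥(EΛ triGraph Λ)) → Blk Φ) : Finset Φ := if ∀ k, w (Sum.inl o) k = true then univ else ∅

variable (grow : (Φ × Φ → Bool) → Φ → Finset Φ)

/-- **The usable set of an entered site**: grown inside its fibre (bits `y`) from one entry cell — a cell of the parent's
usable set `H` whose layer edge is open (`h`); `∅` if there is none. -/
def υ (h : Φ → Bool) (H : Finset Φ) (y : Φ × Φ → Bool) : Finset Φ :=
  if hm : (H.filter fun i => h i = true).Nonempty then grow y (Classical.choose hm) else ∅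

/-- `v` is ENTERED from `c` at the state `τ` under the oracle `x`: the edge `{c, v}` is examined and reported open
(a predicate of this file, not a cited fact). -/
def Entered (x : (↥(EΛ triGraph Λ) → Option Bool) → ↥(EΛ triGraph Λ) → Bool) (τ : ↥(EΛ triGraph Λ) → Option Bool)
    (c v : ↥Λ) : Prop :=
  ∃ e ∈ rule o enc τ, (e : Sym2 (Site 2)) = s(c.1, v.1) ∧ x τ e = true

open Classical in
/-- **Usable sets along a run** with oracle `x`: after `k` steps, the usable set of `v` (`∅` = junk for unentered sites). -/
def usableX (w : (↥Λ ⊕ ↥(EΛ triGraph Λ)) → Blk Φ) (x : (↥(EΛ triGraph Λ) → Option Bool) → ↥(EΛ triGraph Λ) → Bool) :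
    ℕ → ↥Λ → Finset Φ
  | 0 => fun v => if v = o then rootU o w else ∅
  | k + 1 => fun v =>
      match sel o enc (run (rule o enc) x k) with
      | none => usableX w x k v
      | some c => if Entered o enc x (run (rule o enc) x k) c v then υ grow (hE w c v) (usableX w x k c) (yOf w v)
          else usableX w x k v

/-- **The usable set read by the oracle** at state `σ`: replay `σ` for `|EΛ| + 1` steps. -/
def usableAt (w : (↥Λ ⊕ ↥(EΛ triGraph Λ)) → Blk Φ) (σ : ↥(EΛ triGraph Λ) → Option Bool) (c : ↥Λ) : Finset Φ :=
  usableX o enc grow w (readOut σ) (Fintype.card ↥(EΛ triGraph Λ) + 1) c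

/-- **The bond fibre oracle**: for an examined edge `e` (from the selected site `c`), report whether some layer edge of `e`
at a usable cell of `c` is open. -/
def outB (w : (↥Λ ⊕ ↥(EΛ triGraph Λ)) → Blk Φ) (σ : ↥(EΛ triGraph Λ) → Option Bool) (e : ↥(EΛ triGraph Λ)) : Bool :=
  match sel o enc σ with
  | none => false
  | some c => meetsU (hOf w e) (usableAt o enc grow w σ c)

variable {o enc grow}

/-- With selected site `c` the oracle reports `meetsU (hOf w e) (usableAt w σ c)`. -/
theorem outB_sel (w : (↥Λ ⊕ ↥(EΛ triGraph Λ)) → Blk Φ) {σ : ↥(EΛ triGraph Λ) → Option Bool} {c : ↥Λ}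
    (hsel : sel o enc σ = some c) (e : ↥(EΛ triGraph Λ)) :
    outB o enc grow w σ e = meetsU (hOf w e) (usableAt o enc grow w σ c) := by unfold outB; rw [hsel]

/-- With no selected site the oracle reports `false`. -/
theorem outB_none (w : (↥Λ ⊕ ↥(EΛ triGraph Λ)) → Blk Φ) {σ : ↥(EΛ triGraph Λ) → Option Bool}
    (hsel : sel o enc σ = none) (e : ↥(EΛ triGraph Λ)) : outB o enc grow w σ e = false := by unfold outB; rw [hsel]

/-! ### The calculus of usable sets -/

section Calculus

variable (w : (↥Λ ⊕ ↥(EΛ triGraph Λ)) → Blk Φ) (x : (↥(EΛ triGraph Λ) → Option Bool) → ↥(EΛ triGraph Λ) → Bool)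

/-- Step `k + 1` when no site is selected: nothing changes. -/
theorem usableX_succ_of_none {k : ℕ} (h : sel o enc (run (rule o enc) x k) = none) (v : ↥Λ) :
    usableX o enc grow w x (k + 1) v = usableX o enc grow w x k v := by simp only [usableX]; rw [h]

/-- Step `k + 1` for a site entered from the selected site `c`. -/
theorem usableX_succ_of_entered {k : ℕ} {c : ↥Λ} (h : sel o enc (run (rule o enc) x k) = some c) {v : ↥Λ}
    (hv : Entered o enc x (run (rule o enc) x k) c v) :
    usableX o enc grow w x (k + 1) v = υ grow (hE w c v) (usableX o enc grow w x k c) (yOf w v) := by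
  simp only [usableX]; rw [h]; simp only [if_pos hv]

/-- Step `k + 1` for a site not entered from the selected site `c`: nothing changes. -/
theorem usableX_succ_of_not_entered {k : ℕ} {c : ↥Λ} (h : sel o enc (run (rule o enc) x k) = some c) {v : ↥Λ}
    (hv : ¬ Entered o enc x (run (rule o enc) x k) c v) :
    usableX o enc grow w x (k + 1) v = usableX o enc grow w x k v := by
  simp only [usableX]; rw [h]; simp only [if_neg hv]

omit [Fintype Φ] in
/-- A site entered from the selected site `c` is the unreached endpoint of an examined edge, adjacent to `c`. -/
theorem entered_spec {τ : ↥(EΛ triGraph Λ) → Option Bool} {c v : ↥Λ} (hsel : sel o enc τ = some c)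
    (h : Entered o enc x τ c v) :
    ∃ e ∈ rule o enc τ, (e : Sym2 (Site 2)) = s(c.1, v.1) ∧ x τ e = true ∧ triGraph.Adj c.1 v.1 ∧ v ∉ reached o τ := by
  obtain ⟨e, he, hev, hx⟩ := h
  have hadj : triGraph.Adj c.1 v.1 := (SimpleGraph.mem_edgeSet triGraph).1 (hev ▸ (mem_EΛ_iff.1 e.2).2)
  have he' := he
  rw [rule_of_sel hsel, mem_linkable_iff] at he'
  obtain ⟨-, a, ha, hea⟩ := he'
  have hva : v = a := eq_of_mk_eq (G := triGraph) hadj (hev.symm.trans hea)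
  exact ⟨e, he, hev, hx, hadj, hva ▸ ha⟩

omit [Fintype Φ] in
/-- An entered site is reached from the next step on. -/
theorem reached_of_entered {k : ℕ} {c v : ↥Λ} (hsel : sel o enc (run (rule o enc) x k) = some c)
    (h : Entered o enc x (run (rule o enc) x k) c v) {n : ℕ} (hn : k + 1 ≤ n) : v ∈ reached o (run (rule o enc) x n) := by
  obtain ⟨e, he, hev, hx, -, -⟩ := entered_spec x hsel h
  refine reached_mono x hn (mem_reached_iff.2 (Or.inr ⟨e, ?_, by rw [hev]; exact Sym2.mem_iff.2 (Or.inr rfl)⟩))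
  rw [run_succ_apply_of_mem x k he, hx]

omit [Fintype Φ] in
/-- **A site is entered at most once**: a site entered at step `k₀` is not entered at any later step. -/
theorem not_entered_of_entered {k₀ : ℕ} {c v : ↥Λ} (hsel : sel o enc (run (rule o enc) x k₀) = some c)
    (h : Entered o enc x (run (rule o enc) x k₀) c v) {k : ℕ} (hk : k₀ + 1 ≤ k) {c' : ↥Λ}
    (hsel' : sel o enc (run (rule o enc) x k) = some c') : ¬ Entered o enc x (run (rule o enc) x k) c' v := fun h' => by
  obtain ⟨-, -, -, -, -, hv⟩ := entered_spec x hsel' h'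
  exact hv (reached_of_entered x hsel h hk)

/-- **Stability**: the usable set of a site entered at step `k₀` does not change after step `k₀ + 1`. -/
theorem usableX_stable {k₀ : ℕ} {c v : ↥Λ} (hsel : sel o enc (run (rule o enc) x k₀) = some c)
    (h : Entered o enc x (run (rule o enc) x k₀) c v) :
    ∀ k, k₀ + 1 ≤ k → usableX o enc grow w x k v = usableX o enc grow w x (k₀ + 1) v := by
  intro k hk
  induction k with
  | zero => exact absurd hk (by omega)
  | succ k ih =>
    rcases Nat.lt_or_eq_of_le hk with hlt | heq
    · have ih' := ih (by omega)
      cases hs : sel o enc (run (rule o enc) x k) with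
      | none => rw [usableX_succ_of_none w x hs, ih']
      | some c' =>
        rw [usableX_succ_of_not_entered w x hs (not_entered_of_entered x hsel h (by omega) hs), ih']
    · rw [heq]

/-- **The root keeps its usable set** `rootU` (it is never entered). -/
theorem usableX_root : ∀ k, usableX o enc grow w x k o = rootU o w
  | 0 => by simp [usableX]
  | k + 1 => by
    cases hs : sel o enc (run (rule o enc) x k) with
    | none => rw [usableX_succ_of_none w x hs]; exact usableX_root k
    | some c =>
      have hno : ¬ Entered o enc x (run (rule o enc) x k) c o := fun h => by
        obtain ⟨-, -, -, -, -, hv⟩ := entered_spec x hs h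
        exact hv (root_mem_reached _)
      rw [usableX_succ_of_not_entered w x hs hno]; exact usableX_root k

/-- **Prefix congruence**: usable sets after `k` steps depend only on the states up to step `k`. -/
theorem usableX_congr {x x' : (↥(EΛ triGraph Λ) → Option Bool) → ↥(EΛ triGraph Λ) → Bool} {k : ℕ}
    (h : ∀ j ≤ k, run (rule o enc) x j = run (rule o enc) x' j) :
    usableX o enc grow w x k = usableX o enc grow w x' k := by
  induction k with
  | zero => rfl
  | succ k ih =>
    have ih' := ih fun j hj => h j (hj.trans (Nat.le_succ k))
    have hk := h k (Nat.le_succ k)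
    have hent : ∀ c v, Entered o enc x (run (rule o enc) x k) c v ↔ Entered o enc x' (run (rule o enc) x' k) c v := by
      intro c v
      have hval : ∀ e ∈ rule o enc (run (rule o enc) x k), x (run (rule o enc) x k) e = x' (run (rule o enc) x k) e := by
        intro e he
        have h1 := run_succ_apply_of_mem x k he
        have he' : e ∈ rule o enc (run (rule o enc) x' k) := by rw [← hk]; exact he
        have h2 := run_succ_apply_of_mem x' k he'
        rw [← hk] at h2
        rw [h (k + 1) le_rfl] at h1
        rw [h1] at h2
        exact Option.some.inj h2
      unfold Entered
      rw [← hk]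
      constructor
      · rintro ⟨e, he, hev, hx⟩; exact ⟨e, he, hev, by rw [← hval e he]; exact hx⟩
      · rintro ⟨e, he, hev, hx⟩; exact ⟨e, he, hev, by rw [hval e he]; exact hx⟩
    funext v
    cases hs : sel o enc (run (rule o enc) x k) with
    | none =>
      rw [usableX_succ_of_none w x hs, usableX_succ_of_none w x' (hk ▸ hs), ih']
    | some c =>
      by_cases he : Entered o enc x (run (rule o enc) x k) c v
      · rw [usableX_succ_of_entered w x hs he, usableX_succ_of_entered w x' (hk ▸ hs) ((hent c v).1 he), ih']
      · rw [usableX_succ_of_not_entered w x hs he,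
          usableX_succ_of_not_entered w x' (hk ▸ hs) (fun h' => he ((hent c v).2 h')), ih']

/-- A step with an entered site is not terminal, hence has index `≤ |EΛ|`. -/
theorem le_card_of_entered {k : ℕ} {c v : ↥Λ} (h : Entered o enc x (run (rule o enc) x k) c v) :
    k + 1 ≤ Fintype.card ↥(EΛ triGraph Λ) + 1 := by
  obtain ⟨e, he, -, -⟩ := h
  rcases nrev_run_ge (rule_unrevealed (o := o) (enc := enc)) x k with ⟨j, hj, hje⟩ | hge
  · exfalso
    have := run_eq_of_empty x hje k hj
    rw [this, hje] at he
    simp at he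
  · have : ClusterExpl.nrev (run (rule o enc) x (k + 1)) ≤ Fintype.card ↥(EΛ triGraph Λ) := by
      unfold ClusterExpl.nrev; exact card_le_univ _
    omega

/-- **The oracle's usable set along a run**: at the state of step `n`, the usable set read for a site `v` entered at an
earlier step `k₀ < n` is its run value `usableX w x (k₀ + 1) v`. -/
theorem usableAt_run {n k₀ : ℕ} (hk₀ : k₀ < n) {c v : ↥Λ} (hsel : sel o enc (run (rule o enc) x k₀) = some c)
    (h : Entered o enc x (run (rule o enc) x k₀) c v) :
    usableAt o enc grow w (run (rule o enc) x n) v = usableX o enc grow w x (k₀ + 1) v := by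
  unfold usableAt
  set σ := run (rule o enc) x n with hσ
  have hpre := run_readOut_run (rule_unrevealed (o := o) (enc := enc)) x n
  -- the replay agrees up to step `n`, so `v` is entered at step `k₀` of the replay as well
  have hsel' : sel o enc (run (rule o enc) (readOut σ) k₀) = some c := by rw [hpre k₀ hk₀.le]; exact hsel
  have h' : Entered o enc (readOut σ) (run (rule o enc) (readOut σ) k₀) c v := by
    obtain ⟨e, he, hev, hx⟩ := h
    refine ⟨e, by rw [hpre k₀ hk₀.le]; exact he, hev, ?_⟩
    have h1 := run_succ_apply_of_mem (readOut σ) k₀ (R := rule o enc) (by rw [hpre k₀ hk₀.le]; exact he)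
    have h2 := run_succ_apply_of_mem x k₀ he
    rw [hpre (k₀ + 1) (Nat.succ_le_of_lt hk₀), h2, hx] at h1
    exact (Option.some.inj h1).symm
  rw [usableX_stable w (readOut σ) hsel' h' (Fintype.card ↥(EΛ triGraph Λ) + 1) (le_card_of_entered (readOut σ) h')]
  exact congrFun (usableX_congr w fun j hj => hpre j (by omega)) v

/-- **The root's usable set read at any state is `rootU`.** -/
theorem usableAt_root (σ : ↥(EΛ triGraph Λ) → Option Bool) : usableAt o enc grow w σ o = rootU o w :=
  usableX_root w (readOut σ) _

end Calculus

/-! ### The `𝕋 × F` bond configuration and the soundness of the process -/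

section Sound

variable (FA : SimpleGraph Φ) (ek : Φ → Φ → Φ × Φ)

variable (Λ) in
/-- **The `𝕋 × F` bond configuration of a block assignment**: the internal edge `((v,a),(v,b))` of the fibre of `v` is open
iff the bit `ek a b` of the block of `v` is set; the layer edge `((c,i),(a,i))` of the `𝕋`-edge `e = {c, a}` is open iff the
bit `i` of the block of `e` is set. -/
def cfgB (w : (↥Λ ⊕ ↥(EΛ triGraph Λ)) → Blk Φ) : BondConfig (Site 2 × Φ) :=
  {E | (∃ v : ↥Λ, ∃ a b : Φ, FA.Adj a b ∧ yOf w v (ek a b) = true ∧ E = s((v.1, a), (v.1, b))) ∨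
    (∃ e : ↥(EΛ triGraph Λ), ∃ c a : ↥Λ, (e : Sym2 (Site 2)) = s(c.1, a.1) ∧
      ∃ i : Φ, hOf w e i = true ∧ E = s((c.1, i), (a.1, i)))}

variable (i₀ : Φ)

variable (o) in
/-- Joined to the root cell `(o, i₀)` by open edges of `cfgB w` (a predicate of this file, not a cited fact). -/
def Joined (w : (↥Λ ⊕ ↥(EΛ triGraph Λ)) → Blk Φ) (q : Site 2 × Φ) : Prop :=
  PathIn (openGraph (cfgB Λ FA ek w)) Set.univ (o.1, i₀) q

variable {FA ek i₀}

omit [Fintype Φ] in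
/-- An open internal edge extends a junction. -/
theorem Joined.internal {w : (↥Λ ⊕ ↥(EΛ triGraph Λ)) → Blk Φ} {v : ↥Λ} {a b : Φ} (h : Joined o FA ek i₀ w (v.1, a))
    (hab : FA.Adj a b) (hy : yOf w v (ek a b) = true) : Joined o FA ek i₀ w (v.1, b) := by
  refine PathIn.tail h ((openGraph_adj _ _ _).2 ⟨Or.inl ⟨v, a, b, hab, hy, rfl⟩, ?_⟩) (Set.mem_univ _)
  intro heq; exact hab.ne (Prod.mk.inj heq).2

omit [Fintype Φ] in
/-- An open layer edge extends a junction (either direction). -/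
theorem Joined.layer {w : (↥Λ ⊕ ↥(EΛ triGraph Λ)) → Blk Φ} {e : ↥(EΛ triGraph Λ)} {c a : ↥Λ}
    (he : (e : Sym2 (Site 2)) = s(c.1, a.1)) {i : Φ} (hi : hOf w e i = true) {u v : ↥Λ}
    (huv : (u = c ∧ v = a) ∨ (u = a ∧ v = c)) (h : Joined o FA ek i₀ w (u.1, i)) : Joined o FA ek i₀ w (v.1, i) := by
  have hadj : triGraph.Adj c.1 a.1 := (SimpleGraph.mem_edgeSet triGraph).1 (he ▸ (mem_EΛ_iff.1 e.2).2)
  have hmem : s((c.1, i), (a.1, i)) ∈ cfgB Λ FA ek w := Or.inr ⟨e, c, a, he, i, hi, rfl⟩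
  refine PathIn.tail h ((openGraph_adj _ _ _).2 ⟨?_, ?_⟩) (Set.mem_univ _)
  · rcases huv with ⟨rfl, rfl⟩ | ⟨rfl, rfl⟩
    · exact hmem
    · rw [Sym2.eq_swap]; exact hmem
  · rcases huv with ⟨rfl, rfl⟩ | ⟨rfl, rfl⟩
    · intro heq; exact hadj.ne (Prod.mk.inj heq).1
    · intro heq; exact hadj.ne (Prod.mk.inj heq).1.symm

variable (hgrow : ∀ (y : Φ × Φ → Bool) (i j : Φ), j ∈ grow y i →
    Relation.ReflTransGen (fun a b => FA.Adj a b ∧ y (ek a b) = true) i j)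
  (hconn : ∀ j, Relation.ReflTransGen FA.Adj i₀ j)
include hgrow hconn
omit [Fintype Φ] in
/-- Growing inside a fibre from a joined cell stays joined. -/
theorem joined_of_mem_grow {w : (↥Λ ⊕ ↥(EΛ triGraph Λ)) → Blk Φ} {v : ↥Λ} {i j : Φ} (hi : Joined o FA ek i₀ w (v.1, i))
    (hj : j ∈ grow (yOf w v) i) : Joined o FA ek i₀ w (v.1, j) := by
  have _ := hconn
  have h := hgrow _ _ _ hj
  clear hj
  induction h with
  | refl => exact hi
  | tail _ hbc ih => exact ih.internal hbc.1 hbc.2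

/-- **Soundness of the usable-set process**: every usable cell of every site is joined to the root cell `(o, i₀)` by open
edges of `cfgB w` — for every oracle. -/
theorem joined_of_mem_usableX (w : (↥Λ ⊕ ↥(EΛ triGraph Λ)) → Blk Φ)
    (x : (↥(EΛ triGraph Λ) → Option Bool) → ↥(EΛ triGraph Λ) → Bool) :
    ∀ (k : ℕ) (v : ↥Λ) (j : Φ), j ∈ usableX o enc grow w x k v → Joined o FA ek i₀ w (v.1, j)
  | 0, v, j, hj => by
    simp only [usableX] at hj
    split_ifs at hj with hv
    · rw [hv]
      unfold rootU at hj
      split_ifs at hj with hall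
      · -- all internal bits of the root block are set: walk inside the fibre of `o`
        have step : ∀ j, Relation.ReflTransGen FA.Adj i₀ j → Joined o FA ek i₀ w (o.1, j) := by
          intro j h
          induction h with
          | refl => exact PathIn.refl (Set.mem_univ _)
          | tail _ hbc ih => exact ih.internal hbc (hall _)
        exact step j (hconn j)
      · simp at hj
    · simp at hj
  | k + 1, v, j, hj => by
    cases hs : sel o enc (run (rule o enc) x k) with
    | none => rw [usableX_succ_of_none w x hs] at hj; exact joined_of_mem_usableX w x k v j hj
    | some c =>
      by_cases he : Entered o enc x (run (rule o enc) x k) c v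
      · rw [usableX_succ_of_entered w x hs he] at hj
        unfold υ at hj
        split_ifs at hj with hm
        · -- the entry cell `i`: usable for `c`, layer edge open
          set i := Classical.choose hm with hi
          have hi' : i ∈ (usableX o enc grow w x k c).filter fun i => hE w c v i = true := Classical.choose_spec hm
          rw [mem_filter] at hi'
          obtain ⟨e, -, hev, -⟩ := he
          have hci : Joined o FA ek i₀ w (c.1, i) := joined_of_mem_usableX w x k c i hi'.1
          have hvi : Joined o FA ek i₀ w (v.1, i) :=
            hci.layer hev (by rw [← hE_eq_hOf w hev]; exact hi'.2) (Or.inl ⟨rfl, rfl⟩)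
          exact joined_of_mem_grow hgrow hconn hvi hj
        · simp at hj
      · rw [usableX_succ_of_not_entered w x hs he] at hj; exact joined_of_mem_usableX w x k v j hj

/-- **If the payoff of the final state is `1`, the root cell is joined by open edges of `cfgB w` to the fibre of a target
site.** -/
theorem exists_joined_of_reach (w : (↥Λ ⊕ ↥(EΛ triGraph Λ)) → Blk Φ) (B : Finset ↥Λ) (ω₀ : ↥(EΛ triGraph Λ) → Bool)
    (h : reachInd triGraph o B
      (merge (run (rule o enc) (outB o enc grow w) (Fintype.card ↥(EΛ triGraph Λ) + 1)) ω₀) = 1) :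
    ∃ v ∈ B, ∃ j : Φ, Joined o FA ek i₀ w (v.1, j) := by
  set x := outB o enc grow w with hx
  set N := Fintype.card ↥(EΛ triGraph Λ) + 1 with hN
  obtain ⟨v, hvB, hv⟩ := exists_reached_of_reachInd B x ω₀ h
  refine ⟨v, hvB, ?_⟩
  rcases mem_reached_iff.1 hv with rfl | ⟨e, he, hve⟩
  · exact ⟨i₀, PathIn.refl (Set.mem_univ _)⟩
  · -- `e` was examined at a step `k < N` from the selected site `c` and reported open
    obtain ⟨k, hk, heR⟩ := exists_step_of_ne_none x N e (by rw [he]; simp)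
    obtain ⟨c, hsel, -, a, -, hea⟩ := exists_of_mem_rule heR
    have hval := run_apply_of_mem (rule_unrevealed (o := o) (enc := enc)) x hk heR
    rw [he] at hval
    have hrep : x (run (rule o enc) x k) e = true := (Option.some.inj hval).symm
    rw [hx, outB_sel w hsel] at hrep
    obtain ⟨i, hiU, hi⟩ := meetsU_eq_true_iff.1 hrep
    -- `i` is usable for `c`: joined; the open layer edge joins both endpoints of `e` at layer `i`
    have hci : Joined o FA ek i₀ w (c.1, i) := joined_of_mem_usableX hgrow hconn w (readOut _) _ c i hiU
    have hai : Joined o FA ek i₀ w (a.1, i) := hci.layer hea hi (Or.inl ⟨rfl, rfl⟩)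
    rw [hea] at hve
    rcases Sym2.mem_iff.1 hve with hvc | hva
    · exact ⟨i, by rw [show v = c from Subtype.ext hvc]; exact hci⟩
    · exact ⟨i, by rw [show v = a from Subtype.ext hva]; exact hai⟩

end Sound

end BFib

end Summit.CriticalPhenomena.PercolationContinuityZ3.Theorems.Pcint

end
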